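import Literature.Computability.Cryptography.RegevReductionCVPLiftStep
import Literature.Computability.Cryptography.RegevReductionCVPLiftExact
import Literature.Computability.Complexity.CodeFPOfUnary
import Literature.Computability.Complexity.CodeFPTableKit
import HarnessLib

/-!
# Regev 2009, Lemma 3.5 — the post-processing program, and `A_lift` from an exact-CVP finish

Literature first-formalisation unit `b2b-lwe-3` (generation 6, seventh module), bundle
`papers/QuantumAdvantage/lwe-quantum-autopsy/`.  THE VALUE of this file is a THEOREM about a KNOWN
reduction (O. Regev, *On lattices, learning with errors, random linear codes, and cryptography*, J. ACM
56 (2009), Lemma 3.5) — NOT summit progress: nothing here bears on `BQP ≠ BPP`, on the hardness of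
`LWE`, or on any open problem.

## What is proved

`RegevReductionCVPLiftPre.regev2009_lemma_3_5_liftFamily_of_postFn` left the named fact `A_lift`
(`regev2009_lemma_3_5_liftFamily q`: a uniform `CVP^{(q)}` circuit family lifts to a uniform
`CVP_{L*}` family, polynomially many uses, linear union bound) hinging on ONE classical polynomial-time
post-processing program `g` with a window discipline.  This file BUILDS `g` and proves the discipline,
so that `A_lift` now follows from a much smaller, purely classical statement — the FINISH:

* **`regev2009_lemma_3_5_finishFamily q`** (named fact `A_fin`, `def … : Prop` with a body, used as a
  hypothesis): some map `bab : (instance, rational coordinates) ↦ integer coordinates`, computed on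
  codes in polynomial time, returns on the `2n`-th true iterate `x̃_{2n}` of every admissible query the
  dual-basis coordinates `CVPOracle.coords` of the closest dual lattice vector.  KNOWN (Babai's nearest
  plane on an LLL-reduced basis decodes exactly below half the last Gram–Schmidt norm, and `x̃_{2n}` is
  within `d/q^{2n} < λ₁(L*)/2^{2n+1}`); the MATHEMATICS is already in the tree
  (`DigitOracle.coords_iter_eq_repr_nearestPlane`, `DigitOracle.coords_eq_of_isLLLReduced`); what is
  named is the MACHINE (LLL, `exists_lllMachineF_encode_eq`, then integer nearest plane,
  `Babai.coeffsL_codeFP`, on codes) with its semantics.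
* **`regev2009_lemma_3_5_liftFamily_of_finishFamily : A_fin q → A_lift q`** — PROVED.

The construction (grouping namespace `Regev2009.LiftPost`, on top of `RegevReductionCVPLiftStep`):
the context read off the query (`nOf`, `mOf`, `bcOf`, `rrOf` + certificates); three TYPED stage
programs — `g0T` (stage `0`: `x̃₀ = s/2^ℓ` from the query by `LiftPre.ratList`, zero sums, step,
window), `g1T` (stages `1 … 2n−1`: parse the window `wE (x̃ᵢ, Sᵢ, pad)`, step; before the last round
write the window, at the last round `fin1`: `bab`, back-substitution `finCoeffs`, offset-binary table
`tableZL`, cut to width), `copyT` (idle stages re-emit the window) — each with a `CodeFP` certificate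
(`codeFP_g0T`, `codeFP_g1T`, `codeFP_copyT`), glued at STRING level by the tree's branching combinator
`iteFn` on two computed dispatch bits `P0`, `P3` (**`exists_postFn`**; the typed and untyped stage data
have the same code, `w1E_eq`, so the dispatch sees every stage); the true digit path — partial sums
`psum` (`psum_succ`, `0 ≤ Sᵢ < qⁱ`: `psum_nonneg`, `psum_lt`), the iterates in CLOSED FORM
**`iter_ratOf_eq`** (`x̃ᵢ = (s − 2^ℓ Sᵢ)/(2^ℓ qⁱ)`), hence the code-length bounds
`length_encodeRat_iter_le`, `length_intE_psum_le`, **`length_content_le`** (the `i`-th window content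
has `≤ 20 n (ℓ + i·size q + 1) + 60 n + 8` bits — referee note N-14.4 — dominated by the width
polynomial `40 X² P_q(X) + 100 X + 8`, `P_q` the output-length polynomial of the modulus program,
`CodeFP.exists_length_le_eval`), `n_le_length_query`; and the assembly, whose good windows are
`mkWindow m x̃ᵢ Sᵢ` for `1 ≤ i < 2n` and the padded answer table from round `2n` on (stage count
`2|x|+1 ≥ 2n`, referee note N-14.5; zero-dimensional instances have no working stage).

Everything is proved (`#print axioms`: `propext`, `Classical.choice`, `Quot.sound`); the one `def … :
Prop` is the named fact `A_fin` above, stated with a body and never asserted.  Net effect on the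
bundle's trust base: `A_lift` is DISCHARGED MODULO `A_fin` (it is NOT proved outright here).

## References

* O. Regev, *On lattices, learning with errors, random linear codes, and cryptography*, J. ACM 56 (2009),
  art. 34; author's version arXiv:2401.03703: Lemma 3.5 (proof, p. 19) [Regev2009].
* L. Babai, *On Lovász' lattice reduction and the nearest lattice point problem*, Combinatorica 6 (1986),
  Thm 3.1 [Babai1986].
* S. Arora, B. Barak, *Computational Complexity: A Modern Approach*, CUP 2009, §1.2–1.3 [AroraBarak2009].
-/

namespace Literature.Computability.Cryptography

open Filter _root_.Computability Literature.Computability.Complexity Literature.Computability.Complexity.CodeFP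
open Literature.Computability.QuantumComplexity Literature.Algebra.EuclideanLattices
open Regev2009 Regev2009.DigitOracle Regev2009.SamplerFormats Brick

namespace Regev2009

namespace LiftPost

open LiftPre

/-! ### Context read off the query part `d : XData` -/

/-- The dimension `n` of the instance in the query. [cite: Regev2009, Lemma 3.5 (proof)] -/
def nOf (d : XData) : ℕ := d.1.1.1.1.n

/-- The window width `ms(|x|)`. [cite: AroraBarak2009, §1.3] -/
def mOf (ms : Polynomial ℕ) (d : XData) : ℕ := ms.eval (xE d).length

/-- The answer precision `b_c`, capped at `|x|` (on admissible queries of positive dimension the cap is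
void: `n·b_c ≤ n·ℓ_R ≤ |x|`). [cite: Regev2009, Lemma 3.5 (proof)] -/
def bcOf (d : XData) : ℕ := min d.1.2.2 (xE d).length

/-- The claimed digits read off an answer: `n` blocks of `size (q n)` bits. [cite: Regev2009, Lemma 3.5 (proof)] -/
def rrOf (q : ℕ → ℕ) (d : XData) (yy : List Bool) : List ℕ := readN (Nat.size (q (nOf d))) (nOf d) yy

/-- `n` is read off the query in polynomial time. [cite: AroraBarak2009, §1.3] -/
theorem codeFP_nOf : CodeFP xE unE nOf := GapCodes.svpNUn_codeFP.comp (fst _ _).fst'.fst'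

/-- The window width is computed in polynomial time. [cite: AroraBarak2009, §1.3] -/
theorem codeFP_mOf (ms : Polynomial ℕ) : CodeFP xE unE (mOf ms) :=
  (unPoly_codeFP ms).comp (strLength.comp
    ((CodeFP.id xE).recodeOut (eγ := strE) (g' := fun d => xE d) fun _ => rfl))

/-- The capped precision is computed in polynomial time. [cite: AroraBarak2009, §1.3] -/
theorem codeFP_bcOf : CodeFP xE unE bcOf := by
  have hl : CodeFP xE unE (fun d => (xE d).length) :=
    strLength.comp ((CodeFP.id xE).recodeOut (eγ := strE) (g' := fun d => xE d) fun _ => rfl)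
  have h := unOfNatMin.comp (hl.pair (fst _ _).snd'.snd')
  -- `simp only`, not `rfl`: a definitional check would unfold `min` into its `if` and evaluate `|xE d|`
  exact h.congr fun d => by simp only [bcOf]

/-- The claimed digits are read in polynomial time. [cite: AroraBarak2009, §1.3] -/
theorem codeFP_rrOf {q : ℕ → ℕ} (hq : PolyTimeComputable unaryEncodeNat encodeNat q) :
    CodeFP (pairE xE strE) (rawE natE) (fun p => rrOf q p.1 p.2) := by
  have hn : CodeFP (pairE xE strE) unE (fun p => nOf p.1) := codeFP_nOf.comp (fst _ _)
  have hw : CodeFP (pairE xE strE) unE (fun p => Nat.size (q (nOf p.1))) :=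
    natSizeU_codeFP.comp ((codeFP_natParam hq).comp hn)
  exact codeFP_readN.comp (hw.pair (hn.pair (snd _ _)))

/-! ### The three typed stage programs -/

/-- **Stage 0** (window empty): the iterate is `x̃₀ = s/2^ℓ` read off the query (`LiftPre.ratList`), the
partial sums are zero; the stepped iterate `x̃₁`. [cite: Regev2009, Lemma 3.5 (proof)] -/
def step0 (q : ℕ → ℕ) (b : SData × List Bool) : List ℚ :=
  stepL (q (nOf b.1.1)) (ratList b.1.1) (rrOf q b.1.1 b.2)

/-- … and the first partial sums `q⁰ r̃₀`. [cite: Regev2009, Lemma 3.5 (proof)] -/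
def sums0 (q : ℕ → ℕ) (b : SData × List Bool) : List ℤ :=
  sumsL (q (nOf b.1.1)) 0 (List.replicate (nOf b.1.1) 0) (rrOf q b.1.1 b.2)

/-- **The stage-0 program**: step and write the window. [cite: Regev2009, Lemma 3.5 (proof)] -/
def g0T (q : ℕ → ℕ) (ms : Polynomial ℕ) (b : SData × List Bool) : List Bool :=
  mkWindow (mOf ms b.1.1) (step0 q b) (sums0 q b)

/-- Typed stage data with a parsed window `(x̃ᵢ, Sᵢ, padding)`, and the answer. [cite: Regev2009, Lemma 3.5 (proof)] -/
abbrev W1Data : Type := (XData × ℕ × (List ℚ × List ℤ × List Bool)) × List Bool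

/-- Its code — the SAME string as the untyped stage datum with window `wE (x̃ᵢ, Sᵢ, padding)`
(`w1E_eq`). [cite: AroraBarak2009, §1.2 (pairing)] -/
abbrev w1E : W1Data → List Bool := pairE (pairE xE (pairE unE wE)) strE

/-- Forgetting the parse of the window. [cite: AroraBarak2009, §1.2 (pairing)] -/
def toS (b : W1Data) : SData × List Bool := ((b.1.1, b.1.2.1, wE b.1.2.2), b.2)

/-- The typed and the untyped stage datum have the same code. [cite: AroraBarak2009, §1.2 (pairing)] -/
theorem w1E_eq (b : W1Data) : w1E b = pairE sE strE (toS b) := rfl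

/-- The stepped iterate `x̃_{i+1}` of a parsed stage. [cite: Regev2009, Lemma 3.5 (proof)] -/
def step1 (q : ℕ → ℕ) (b : W1Data) : List ℚ := stepL (q (nOf b.1.1)) b.1.2.2.1 (rrOf q b.1.1 b.2)

/-- The partial sums `S_{i+1}` of a parsed stage. [cite: Regev2009, Lemma 3.5 (proof)] -/
def sums1 (q : ℕ → ℕ) (b : W1Data) : List ℤ := sumsL (q (nOf b.1.1)) b.1.2.1 b.1.2.2.2.1 (rrOf q b.1.1 b.2)

/-- The final coefficient vector `q^{e} ã + S` (back-substitution). [cite: Regev2009, Lemma 3.5 (proof)] -/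
def finCoeffs (cq e : ℕ) (a S : List ℤ) : List ℤ :=
  List.zipWith (fun (x s : ℤ) => (cq : ℤ) ^ e * x + s) a S

/-- **The finish**: hand `x̃_{i+1}` to the exact-CVP program `bab`, back-substitute with `q^{i+1}`, write
the offset-binary answer table, cut/padded to width. [cite: Regev2009, Lemma 3.5 (proof)] -/
def fin1 (q : ℕ → ℕ) (ms : Polynomial ℕ) (bab : GapSVPInstance × List ℚ → List ℤ) (b : W1Data) : List Bool :=
  (tableZL (bcOf b.1.1) (finCoeffs (q (nOf b.1.1)) (b.1.2.1 + 1) (bab (b.1.1.1.1.1, step1 q b))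
    (sums1 q b))).takeD (mOf ms b.1.1) false

/-- **Stages `1 ≤ i ≤ 2n−1`**: step; before the last round write the window, at the last round
(`i + 1 = 2n`) finish. [cite: Regev2009, Lemma 3.5 (proof)] -/
def g1T (q : ℕ → ℕ) (ms : Polynomial ℕ) (bab : GapSVPInstance × List ℚ → List ℤ) (b : W1Data) : List Bool :=
  if b.1.2.1 + 1 < 2 * nOf b.1.1 then mkWindow (mOf ms b.1.1) (step1 q b) (sums1 q b) else fin1 q ms bab b

/-- **Idle stages** (`i ≥ 2n`, and every stage of a zero-dimensional instance): re-emit the window,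
cut/padded to width. [cite: Regev2009, Lemma 3.5 (proof)] -/
def copyT (ms : Polynomial ℕ) (b : SData × List Bool) : List Bool := b.1.2.2.takeD (mOf ms b.1.1) false

/-- Dispatch bit: stage `0` of a positive-dimensional instance. [cite: Regev2009, Lemma 3.5 (proof)] -/
def P0 (b : SData × List Bool) : Bool := if b.1.2.1 < 1 then decide (0 < nOf b.1.1) else false

/-- Dispatch bit: idle stage (`i ≥ 2n`). [cite: Regev2009, Lemma 3.5 (proof)] -/
def P3 (b : SData × List Bool) : Bool := decide (2 * nOf b.1.1 ≤ b.1.2.1)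

/-- Back-substitution is computed in polynomial time. [cite: AroraBarak2009, §1.3] -/
theorem codeFP_finCoeffs : CodeFP (pairE (pairE natE unE) (pairE (rawE intE) (rawE intE))) (rawE intE)
    (fun p => finCoeffs p.1.1 p.1.2 p.2.1 p.2.2) := by
  have hpow : CodeFP (pairE (pairE natE unE) (pairE intE intE)) natE (fun t => t.1.1 ^ t.1.2) :=
    natPow.comp ((fst _ _).fst'.pair (fst _ _).snd')
  have hel := intAdd.comp ((intMul.comp ((intOfNat.comp hpow).pair (snd _ _).fst')).pair (snd _ _).snd')
  have hel' : CodeFP (pairE (pairE natE unE) (pairE intE intE)) intE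
      (fun t => (t.1.1 : ℤ) ^ t.1.2 * t.2.1 + t.2.2) :=
    hel.congr fun t => by push_cast; ring
  exact (zipWith hel').congr fun p => rfl

/-- The idle stage is computed in polynomial time. [cite: AroraBarak2009, §1.3] -/
theorem codeFP_copyT (ms : Polynomial ℕ) : CodeFP (pairE sE strE) strE (copyT ms) := by
  have h := CodeFP.takeD.comp (((codeFP_mOf ms).comp (fst _ _).fst').pair (fst sE strE).snd'.snd')
  exact h.congr fun b => rfl

/-- The first dispatch bit is computed in polynomial time. [cite: AroraBarak2009, §1.3] -/
theorem codeFP_P0 : CodeFP (pairE sE strE) bitE P0 := by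
  have hi : CodeFP (pairE sE strE) natE (fun b => b.1.2.1) := natOfUn.comp (fst _ _).snd'.fst'
  have hn : CodeFP (pairE sE strE) natE (fun b => nOf b.1.1) := natOfUn.comp (codeFP_nOf.comp (fst _ _).fst')
  have h1 : CodeFP (pairE sE strE) bitE (fun b => decide (b.1.2.1 < 1)) := natLt.comp (hi.pair (const _ 1))
  have h2 : CodeFP (pairE sE strE) bitE (fun b => decide (0 < nOf b.1.1)) := natLt.comp ((const _ 0).pair hn)
  exact (CodeFP.ite h1 h2 (const _ false)).congr fun b => by
    by_cases h : b.1.2.1 < 1 <;> simp [P0, h]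

/-- The second dispatch bit is computed in polynomial time. [cite: AroraBarak2009, §1.3] -/
theorem codeFP_P3 : CodeFP (pairE sE strE) bitE P3 := by
  have hi : CodeFP (pairE sE strE) natE (fun b => b.1.2.1) := natOfUn.comp (fst _ _).snd'.fst'
  have hn : CodeFP (pairE sE strE) unE (fun b => nOf b.1.1) := codeFP_nOf.comp (fst _ _).fst'
  exact (natLe.comp ((natOfUn.comp (unAdd.comp (hn.pair hn))).pair hi)).congr fun b => by
    simp [P3, two_mul]

section Cert

variable {q : ℕ → ℕ} (hq : PolyTimeComputable unaryEncodeNat encodeNat q) (ms : Polynomial ℕ)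
include hq

/-- The stage-0 step is computed in polynomial time. [cite: AroraBarak2009, §1.3] -/
theorem codeFP_step0 : CodeFP (pairE sE strE) (rawE encodeRat) (step0 q) := by
  have hd : CodeFP (pairE sE strE) xE (fun b => b.1.1) := (fst _ _).fst'
  have hcq := (codeFP_natParam hq).comp (codeFP_nOf.comp hd)
  have hrr := (codeFP_rrOf hq).comp (hd.pair (snd sE strE))
  have hL := (rawOfList encodeRat).comp (codeFP_ratList.comp hd)
  exact (codeFP_stepL.comp (hcq.pair (hL.pair hrr))).congr fun b => rfl

/-- The stage-0 sums are computed in polynomial time. [cite: AroraBarak2009, §1.3] -/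
theorem codeFP_sums0 : CodeFP (pairE sE strE) (rawE intE) (sums0 q) := by
  have hd : CodeFP (pairE sE strE) xE (fun b => b.1.1) := (fst _ _).fst'
  have hn := codeFP_nOf.comp hd
  have hcq := (codeFP_natParam hq).comp hn
  have hrr := (codeFP_rrOf hq).comp (hd.pair (snd sE strE))
  have hz := (replicateOf intE).comp ((const (pairE sE strE) (0 : ℤ)).pair hn)
  exact (codeFP_sumsL.comp ((hcq.pair (const _ 0)).pair (hz.pair hrr))).congr fun b => rfl

/-- **The stage-0 program is polynomial time.** [cite: AroraBarak2009, §1.3] -/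
theorem codeFP_g0T : CodeFP (pairE sE strE) strE (g0T q ms) := by
  have h := codeFP_mkWindow.comp ((((codeFP_mOf ms).comp (fst sE strE).fst')).pair
    ((codeFP_step0 hq).pair (codeFP_sums0 hq)))
  exact h.congr fun b => rfl

/-- The step of a parsed stage is computed in polynomial time. [cite: AroraBarak2009, §1.3] -/
theorem codeFP_step1 : CodeFP w1E (rawE encodeRat) (step1 q) := by
  have hd : CodeFP w1E xE (fun b => b.1.1) := (fst _ _).fst'
  have hcq := (codeFP_natParam hq).comp (codeFP_nOf.comp hd)
  have hrr := (codeFP_rrOf hq).comp (hd.pair (snd _ strE))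
  have hLi : CodeFP w1E (listE encodeRat) (fun b => b.1.2.2.1) := (fst _ _).snd'.snd'.fst'
  exact (codeFP_stepL.comp (hcq.pair (((rawOfList encodeRat).comp hLi).pair hrr))).congr fun b => rfl

/-- The sums of a parsed stage are computed in polynomial time. [cite: AroraBarak2009, §1.3] -/
theorem codeFP_sums1 : CodeFP w1E (rawE intE) (sums1 q) := by
  have hd : CodeFP w1E xE (fun b => b.1.1) := (fst _ _).fst'
  have hcq := (codeFP_natParam hq).comp (codeFP_nOf.comp hd)
  have hrr := (codeFP_rrOf hq).comp (hd.pair (snd _ strE))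
  have hi : CodeFP w1E unE (fun b => b.1.2.1) := (fst _ _).snd'.fst'
  have hS : CodeFP w1E (rawE intE) (fun b => b.1.2.2.2.1) := (fst _ _).snd'.snd'.snd'.fst'
  exact (codeFP_sumsL.comp ((hcq.pair hi).pair (hS.pair hrr))).congr fun b => rfl

/-- **The finish is polynomial time** (given the exact-CVP program `bab`). [cite: AroraBarak2009, §1.3] -/
theorem codeFP_fin1 {bab : GapSVPInstance × List ℚ → List ℤ}
    (hbab : CodeFP (pairE GapSVPInstance.encode (listE encodeRat)) (rawE intE) bab) :
    CodeFP w1E strE (fin1 q ms bab) := by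
  have hd : CodeFP w1E xE (fun b => b.1.1) := (fst _ _).fst'
  have hn := codeFP_nOf.comp hd
  have hcq := (codeFP_natParam hq).comp hn
  have hI : CodeFP w1E GapSVPInstance.encode (fun b => b.1.1.1.1.1) := hd.fst'.fst'.fst'
  have hb := hbab.comp (hI.pair ((listOfRaw encodeRat).comp (codeFP_step1 hq)))
  have he : CodeFP w1E unE (fun b => b.1.2.1 + 1) := unSucc.comp (fst _ _).snd'.fst'
  have hfc := codeFP_finCoeffs.comp ((hcq.pair he).pair (hb.pair (codeFP_sums1 hq)))
  have htab := codeFP_tableZL.comp ((codeFP_bcOf.comp hd).pair hfc)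
  have hfin := CodeFP.takeD.comp (((codeFP_mOf ms).comp hd).pair htab)
  exact hfin.congr fun b => rfl

/-- **The parsed-stage program is polynomial time.** [cite: AroraBarak2009, §1.3] -/
theorem codeFP_g1T {bab : GapSVPInstance × List ℚ → List ℤ}
    (hbab : CodeFP (pairE GapSVPInstance.encode (listE encodeRat)) (rawE intE) bab) :
    CodeFP w1E strE (g1T q ms bab) := by
  have hd : CodeFP w1E xE (fun b => b.1.1) := (fst _ _).fst'
  have hn := codeFP_nOf.comp hd
  have hwin' := codeFP_mkWindow.comp (((codeFP_mOf ms).comp hd).pair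
    ((codeFP_step1 hq).pair (codeFP_sums1 hq)))
  have hwin : CodeFP w1E strE (fun b => mkWindow (mOf ms b.1.1) (step1 q b) (sums1 q b)) :=
    hwin'.congr fun b => rfl
  have he : CodeFP w1E unE (fun b => b.1.2.1 + 1) := unSucc.comp (fst _ _).snd'.fst'
  have hp' := natLt.comp ((natOfUn.comp he).pair (natOfUn.comp (unAdd.comp (hn.pair hn))))
  have hp : CodeFP w1E bitE (fun b => decide (b.1.2.1 + 1 < 2 * nOf b.1.1)) :=
    hp'.congr fun b => by simp [two_mul]
  exact (CodeFP.ite hp hwin (codeFP_fin1 hq ms hbab)).congr fun b => by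
    by_cases h : b.1.2.1 + 1 < 2 * nOf b.1.1 <;> simp [g1T, h]

/-- **The post-processing program**: one FP function dispatching, on the stage counter, between the
three typed stage programs. [cite: AroraBarak2009, §1.3] -/
theorem exists_postFn {bab : GapSVPInstance × List ℚ → List ℤ}
    (hbab : CodeFP (pairE GapSVPInstance.encode (listE encodeRat)) (rawE intE) bab) :
    ∃ g : List Bool → List Bool, g ∈ FP ∧
      (∀ b : SData × List Bool, P0 b = true → g (pairE sE strE b) = g0T q ms b) ∧
      (∀ b : SData × List Bool, P0 b = false → P3 b = true → g (pairE sE strE b) = copyT ms b) ∧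
      (∀ b : W1Data, P0 (toS b) = false → P3 (toS b) = false → g (w1E b) = g1T q ms bab b) := by
  obtain ⟨f0, hf0, e0⟩ := codeFP_g0T hq ms
  obtain ⟨f1, hf1, e1⟩ := codeFP_g1T hq ms hbab
  obtain ⟨fc, hfc, ec⟩ := codeFP_copyT ms
  obtain ⟨c0, hc0, ec0⟩ := codeFP_P0
  obtain ⟨c3, hc3, ec3⟩ := codeFP_P3
  refine ⟨iteFn c0 f0 (iteFn c3 fc f1), iteFn_mem_FP hc0 hf0 (iteFn_mem_FP hc3 hfc hf1), ?_, ?_, ?_⟩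
  · intro b hb
    rw [iteFn_apply_true (by rw [ec0, hb]; rfl)]
    exact e0 b
  · intro b hb hb'
    rw [iteFn_apply_false (by rw [ec0, hb]; rfl), iteFn_apply_true (by rw [ec3, hb']; rfl)]
    exact ec b
  · intro b hb hb'
    rw [w1E_eq, iteFn_apply_false (by rw [ec0, hb]; rfl), iteFn_apply_false (by rw [ec3, hb']; rfl), ← w1E_eq]
    exact e1 b

end Cert

/-! ### The true digit path: partial sums, the iterates in closed form, and their code lengths -/

/-- **The partial sums** `Sᵢ = Σ_{l<i} q^l · (a(x̃_l) mod q)` of the true digits (integer vectors).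
[cite: Regev2009, Lemma 3.5 (proof)] -/
noncomputable def psum (cq : ℕ) (I : LatticeInstance) (t : Fin I.n → ℚ) (i : ℕ) (j : Fin I.n) : ℤ :=
  ∑ l ∈ Finset.range i, (cq : ℤ) ^ l * (digits cq I (iter cq I t l) j : ℤ)

/-- `S₀ = 0`. [folklore] -/
@[simp] theorem psum_zero (cq : ℕ) (I : LatticeInstance) (t : Fin I.n → ℚ) : psum cq I t 0 = fun _ => 0 := by
  funext j; simp [psum]

/-- `S_{i+1} = Sᵢ + qⁱ rᵢ`. [cite: Regev2009, Lemma 3.5 (proof)] -/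
theorem psum_succ (cq : ℕ) (I : LatticeInstance) (t : Fin I.n → ℚ) (i : ℕ) :
    psum cq I t (i + 1) = fun j => psum cq I t i j + (cq : ℤ) ^ i * (digits cq I (iter cq I t i) j : ℤ) := by
  funext j; simp [psum, Finset.sum_range_succ]

/-- `0 ≤ Sᵢ`. [cite: Regev2009, Lemma 3.5 (proof)] -/
theorem psum_nonneg (cq : ℕ) (I : LatticeInstance) (t : Fin I.n → ℚ) (i : ℕ) (j : Fin I.n) :
    0 ≤ psum cq I t i j :=
  Finset.sum_nonneg fun l _ => by positivity

/-- `Sᵢ < qⁱ`. [cite: Regev2009, Lemma 3.5 (proof)] -/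
theorem psum_lt (cq : ℕ) [NeZero cq] (I : LatticeInstance) (t : Fin I.n → ℚ) (i : ℕ) (j : Fin I.n) :
    psum cq I t i j < (cq : ℤ) ^ i := by
  induction i with
  | zero => simp
  | succ i ih =>
    rw [psum_succ]
    have hr : (digits cq I (iter cq I t i) j : ℤ) ≤ cq - 1 := by
      have := digits_lt cq I (iter cq I t i) j; omega
    have hq0 : (0 : ℤ) ≤ (cq : ℤ) ^ i := by positivity
    calc psum cq I t i j + (cq : ℤ) ^ i * (digits cq I (iter cq I t i) j : ℤ)
        ≤ ((cq : ℤ) ^ i - 1) + (cq : ℤ) ^ i * (cq - 1) := by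
          have := mul_le_mul_of_nonneg_left hr hq0; omega
      _ < (cq : ℤ) ^ (i + 1) := by
          rw [pow_succ]
          linarith [show (cq : ℤ) ^ i * ((cq : ℤ) - 1) = (cq : ℤ) ^ i * cq - (cq : ℤ) ^ i by ring]

/-- **The iterates in closed form**: `x̃ᵢ = (s − 2^ℓ Sᵢ) / (2^ℓ qⁱ)` coordinatewise.
[cite: Regev2009, Lemma 3.5 (proof: "x_{i+1} = (x_i − (a_i mod p))/p")] -/
theorem iter_ratOf_eq (cq : ℕ) [NeZero cq] (I : LatticeInstance) (c : CVPOracle.QData I.n) (i : ℕ) (j : Fin I.n) :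
    iter cq I (ratOf c) i j =
      (((c.1 j : ℤ) - 2 ^ c.2.1 * psum cq I (ratOf c) i j : ℤ) : ℚ) / ((2 ^ c.2.1 * cq ^ i : ℕ) : ℚ) := by
  induction i with
  | zero => simp [ratOf]
  | succ i ih =>
    rw [iter_succ]
    change (iter cq I (ratOf c) i j - digits cq I (iter cq I (ratOf c) i) j) / cq = _
    rw [ih, psum_succ]
    have hq : (cq : ℚ) ≠ 0 := by exact_mod_cast NeZero.ne cq
    push_cast
    field_simp
    ring

/-- Numerator and denominator of a fraction `N / D` are bounded by `|N|` and `D`. [folklore] -/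
theorem num_natAbs_le_and_den_le (N : ℤ) {D : ℕ} (hD : 0 < D) :
    (((N : ℚ) / (D : ℚ))).num.natAbs ≤ N.natAbs ∧ (((N : ℚ) / (D : ℚ))).den ≤ D := by
  have hD' : (D : ℤ) ≠ 0 := by exact_mod_cast hD.ne'
  have h : (N : ℚ) / (D : ℚ) = Rat.divInt N D := by rw [Rat.divInt_eq_div]; push_cast; rfl
  rw [h]
  refine ⟨?_, ?_⟩
  · rcases eq_or_ne N 0 with rfl | hN
    · simp
    · exact Nat.le_of_dvd (Int.natAbs_pos.2 hN) (Int.natAbs_dvd_natAbs.2 (Rat.num_dvd N hD'))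
  · have := Int.le_of_dvd (by exact_mod_cast hD) (Rat.den_dvd N D)
    exact_mod_cast this

/-- `size (2^ℓ qⁱ) ≤ ℓ + i · size q + 1`. [folklore] -/
theorem size_two_pow_mul_pow_le (ℓ cq i : ℕ) : Nat.size (2 ^ ℓ * cq ^ i) ≤ ℓ + i * Nat.size cq + 1 := by
  rw [Nat.size_le]
  have h1 : cq ^ i ≤ 2 ^ (i * Nat.size cq) := by
    rw [Nat.mul_comm, Nat.pow_mul]; exact Nat.pow_le_pow_left (Nat.lt_size_self cq).le i
  calc 2 ^ ℓ * cq ^ i ≤ 2 ^ ℓ * 2 ^ (i * Nat.size cq) := Nat.mul_le_mul_left _ h1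
    _ = 2 ^ (ℓ + i * Nat.size cq) := (Nat.pow_add _ _ _).symm
    _ < 2 ^ (ℓ + i * Nat.size cq + 1) := Nat.pow_lt_pow_right (by norm_num) (by omega)

/-- **Code length of a true iterate's coordinate**: `≤ 3 (ℓ + i size q + 1) + 10`.
[cite: AroraBarak2009, §1.3] -/
theorem length_encodeRat_iter_le (cq : ℕ) [NeZero cq] (I : LatticeInstance) (c : CVPOracle.QData I.n)
    (hc : CVPOracle.InRange c) (i : ℕ) (j : Fin I.n) :
    (encodeRat (iter cq I (ratOf c) i j)).length ≤ 3 * (c.2.1 + i * Nat.size cq + 1) + 10 := by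
  rw [length_encodeRat, iter_ratOf_eq]
  have hD : 0 < 2 ^ c.2.1 * cq ^ i := Nat.mul_pos (Nat.two_pow_pos _) (Nat.pow_pos (Nat.pos_of_ne_zero (NeZero.ne cq)))
  obtain ⟨hnum, hden⟩ := num_natAbs_le_and_den_le ((c.1 j : ℤ) - 2 ^ c.2.1 * psum cq I (ratOf c) i j) hD
  have hs : c.1 j < 2 ^ c.2.1 := hc j
  have hA0 := psum_nonneg cq I (ratOf c) i j
  have hA1 := psum_lt cq I (ratOf c) i j
  have hN : ((c.1 j : ℤ) - 2 ^ c.2.1 * psum cq I (ratOf c) i j).natAbs ≤ 2 ^ c.2.1 * cq ^ i := by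
    have hs' : (c.1 j : ℤ) < 2 ^ c.2.1 := by exact_mod_cast hs
    have hq1 : (1 : ℤ) ≤ (cq : ℤ) ^ i := one_le_pow₀ (by exact_mod_cast NeZero.one_le)
    have h2 : (0 : ℤ) < 2 ^ c.2.1 := by positivity
    have hup : (c.1 j : ℤ) - 2 ^ c.2.1 * psum cq I (ratOf c) i j ≤ 2 ^ c.2.1 * (cq : ℤ) ^ i := by nlinarith
    have hlo : -(2 ^ c.2.1 * (cq : ℤ) ^ i) ≤ (c.1 j : ℤ) - 2 ^ c.2.1 * psum cq I (ratOf c) i j := by nlinarith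
    have habs : ((((c.1 j : ℤ) - 2 ^ c.2.1 * psum cq I (ratOf c) i j).natAbs : ℕ) : ℤ) ≤
        2 ^ c.2.1 * (cq : ℤ) ^ i := by
      rw [Int.natCast_natAbs]; exact abs_le.2 ⟨hlo, hup⟩
    exact_mod_cast habs
  have hZ := size_two_pow_mul_pow_le c.2.1 cq i
  have h1 := Nat.size_le_size (hnum.trans hN)
  have h2 := Nat.size_le_size (hden)
  omega

/-- **Code length of a partial sum**: `≤ 2 (ℓ + i size q + 1) + 2` (any `ℓ`). [cite: AroraBarak2009, §1.3] -/
theorem length_intE_psum_le (cq : ℕ) [NeZero cq] (I : LatticeInstance) (t : Fin I.n → ℚ) (ℓ i : ℕ) (j : Fin I.n) :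
    (intE (psum cq I t i j)).length ≤ 2 * (ℓ + i * Nat.size cq + 1) + 2 := by
  have hA0 := psum_nonneg cq I t i j
  have hA1 := psum_lt cq I t i j
  have hN : (psum cq I t i j).natAbs ≤ 2 ^ ℓ * cq ^ i := by
    have habs : (((psum cq I t i j).natAbs : ℕ) : ℤ) ≤ 2 ^ ℓ * (cq : ℤ) ^ i := by
      rw [Int.natCast_natAbs, abs_of_nonneg hA0]
      have h2 : (1 : ℤ) ≤ 2 ^ ℓ := one_le_pow₀ (by norm_num)
      nlinarith
    exact_mod_cast habs
  have h := length_intE_le_of_natAbs_le hN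
  have hZ := size_two_pow_mul_pow_le ℓ cq i
  omega

/-- `finCoeffs` on `ofFn` data. [folklore] -/
theorem finCoeffs_ofFn {n : ℕ} (cq e : ℕ) (a S : Fin n → ℤ) :
    finCoeffs cq e (List.ofFn a) (List.ofFn S) = List.ofFn fun j => (cq : ℤ) ^ e * a j + S j :=
  List.ext_getElem (by simp [finCoeffs]) fun i h1 h2 => by simp [finCoeffs]

/-- **The content of the `i`-th good window**: the code of `x̃ᵢ` (with length header) and of `Sᵢ`.
[cite: Regev2009, Lemma 3.5 (proof)] -/
noncomputable def content (cq : ℕ) (I : LatticeInstance) (c : CVPOracle.QData I.n) (i : ℕ) : List Bool :=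
  boolPair (listE encodeRat (List.ofFn (iter cq I (ratOf c) i)))
    (boolPair (rawE intE (List.ofFn (psum cq I (ratOf c) i))) [])

/-- **Its length**: `≤ 20 n (ℓ + i size q + 1) + 60 n + 8`. [cite: AroraBarak2009, §1.3] -/
theorem length_content_le (cq : ℕ) [NeZero cq] (I : LatticeInstance) (c : CVPOracle.QData I.n)
    (hc : CVPOracle.InRange c) (i : ℕ) :
    (content cq I c i).length ≤ 20 * (I.n * (c.2.1 + i * Nat.size cq + 1)) + 60 * I.n + 8 := by
  have hR : (rawE encodeRat (List.ofFn (iter cq I (ratOf c) i))).length ≤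
      I.n * (2 * (3 * (c.2.1 + i * Nat.size cq + 1) + 10) + 2) := by
    have h := length_rawE_le_of_forall (l := List.ofFn (iter cq I (ratOf c) i))
      (B := 3 * (c.2.1 + i * Nat.size cq + 1) + 10) fun a ha => by
      obtain ⟨j, rfl⟩ := (List.mem_ofFn' _ _).1 ha
      exact length_encodeRat_iter_le cq I c hc i j
    rwa [List.length_ofFn] at h
  have hS : (rawE intE (List.ofFn (psum cq I (ratOf c) i))).length ≤
      I.n * (2 * (2 * (c.2.1 + i * Nat.size cq + 1) + 2) + 2) := by
    have h := length_rawE_le_of_forall (l := List.ofFn (psum cq I (ratOf c) i))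
      (B := 2 * (c.2.1 + i * Nat.size cq + 1) + 2) fun a ha => by
      obtain ⟨j, rfl⟩ := (List.mem_ofFn' _ _).1 ha
      exact length_intE_psum_le cq I (ratOf c) c.2.1 i j
    rwa [List.length_ofFn] at h
  simp only [content, listE, length_boolPair, length_unE, List.length_ofFn, List.length_nil]
  nlinarith [hR, hS]

/-- `n ≤ |x|` and `n · ℓ_R ≤ |x|` for a `CVP` query `x`. [cite: Regev2009, Lemma 3.5 (proof)] -/
theorem n_le_length_query (I : LatticeInstance) (ρ : ℚ) (k : ℕ) (y : List Bool) (c : CVPOracle.QData I.n) :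
    I.n ≤ (CVPOracle.query I ρ k y c).length ∧ I.n * c.2.1 ≤ (CVPOracle.query I ρ k y c).length := by
  have h1 : I.n ≤ (GapSVPInstance.encode (I, ρ)).length := n_le_length_encode_gapSVP I ρ
  have h2 : (CVPOracle.table c.2.1 c.1).length = I.n * c.2.1 := by
    rw [← tableL_ofFn, length_tableL, List.length_ofFn]
  have h3 : (CVPOracle.query I ρ k y c).length =
      2 * (boolPair (stageInput (GapSVPInstance.encode (I, ρ)) (k + 1) y)
        (boolPair (encodeNat c.2.1) (encodeNat c.2.2))).length + 2 + (CVPOracle.table c.2.1 c.1).length :=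
    length_boolPair _ _
  have h4 := length_boolPair (stageInput (GapSVPInstance.encode (I, ρ)) (k + 1) y)
    (boolPair (encodeNat c.2.1) (encodeNat c.2.2))
  have h5 : (GapSVPInstance.encode (I, ρ)).length ≤ (stageInput (GapSVPInstance.encode (I, ρ)) (k + 1) y).length := by
    rw [stageInput, length_boolPair]; omega
  omega

end LiftPost

end Regev2009

/-! ### `A_lift` from the finish -/

/-- **Regev 2009, Lemma 3.5 — the finish: exact `CVP` on the last iterate, by ONE classical
polynomial-time program (named fact `A_fin`, the residual of `A_lift`).**  There is a map `bab` on
(instance, rational coordinate vector), computed on codes in polynomial time, which on the `2n`-th true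
iterate `x̃_{2n}` of every admissible `CVP` query of a nonsingular instance (all but finitely many `n`)
returns the dual-basis coordinates `CVPOracle.coords` of the dual lattice vector closest to its point.
KNOWN, and the MATHEMATICS is in the tree: `x̃_{2n}` is within `d/q^{2n} < λ₁(L*)/2^{2n+1}` of `L*`, so
Babai's nearest plane on an LLL-reduced dual basis (reversed) decodes it EXACTLY
(`DigitOracle.coords_iter_eq_repr_nearestPlane`, `DigitOracle.coords_eq_of_isLLLReduced`, Babai 1986
Thm 3.1, LLL 1982 Prop. 1.11); what is NAMED here is only the MACHINE — LLL (`exists_lllMachineF_encode_eq`)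
composed with integer nearest plane (`Babai.coeffsL_codeFP`) on codes, with its semantics.  Informal:
Regev 2009, Lemma 3.5 (proof, last step: "we arrive at a point x_{n+1} … within distance d/pⁿ of the
lattice … hence an exact closest vector can be found efficiently [Babai]").
[cite: Regev2009, Lemma 3.5 (proof); Babai1986, Thm 3.1] -/
def regev2009_lemma_3_5_finishFamily (q : ℕ → ℕ) : Prop :=
  PolyTimeComputable unaryEncodeNat encodeNat q → (∀ᶠ n : ℕ in atTop, 2 ≤ q n) →
    ∃ bab : GapSVPInstance × List ℚ → List ℤ,
      CodeFP (pairE GapSVPInstance.encode (listE encodeRat)) (rawE intE) bab ∧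
      ∀ᶠ n : ℕ in atTop, ∀ (I : LatticeInstance) (ρ : ℚ), I.n = n → I.IsNonsingular →
        ∀ d : ℝ, d < minNorm (dualLattice I.lattice) / 2 →
          ∀ c : CVPOracle.QData I.n, CVPOracle.Admissible I d c →
            bab ((I, ρ), List.ofFn (iter (q n) I (ratOf c) (2 * n))) =
              List.ofFn (CVPOracle.coords I (DigitOracle.point I (iter (q n) I (ratOf c) (2 * n))))


/-- **`A_lift` follows from `A_fin`** (`regev2009_lemma_3_5_liftFamily_of_finishFamily`): the lifting
of a `CVP^{(q)}` circuit family to a `CVP_{L*}^{(‖π(x)‖∞)}` family with polynomially many uses and a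
linear union bound (`regev2009_lemma_3_5_liftFamily`, Regev 2009 Lemma 3.5 as a uniform family) holds
as soon as the exact-`CVP` finish is a polynomial-time program.  Proof: the post-processing program of
`RegevReductionCVPLiftPre.regev2009_lemma_3_5_liftFamily_of_postFn` is BUILT (`LiftPost.exists_postFn`:
stage `0` reads `x̃₀` off the query, stages `1 … 2n−1` parse their own window, the last one finishes,
idle stages re-emit), its good windows are the codes of `(x̃ᵢ, Sᵢ)` padded to the width polynomial
`40 X² P_q(X) + 100 X + 8` (`LiftPost.length_content_le`, from the closed form
`x̃ᵢ = (s − 2^ℓ Sᵢ)/(2^ℓ qⁱ)`, `LiftPost.iter_ratOf_eq`), and the final window is the answer table by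
back-substitution (`DigitOracle.coords_eq_pow_mul_coords_iter_add_sum`).
[cite: Regev2009, Lemma 3.5 (proof)] -/
theorem regev2009_lemma_3_5_liftFamily_of_finishFamily {q : ℕ → ℕ}
    (hF : regev2009_lemma_3_5_finishFamily q) : regev2009_lemma_3_5_liftFamily q := by
  refine regev2009_lemma_3_5_liftFamily_of_postFn q fun hq hq2 T => ?_
  obtain ⟨bab, hbab, hgood⟩ := hF hq hq2
  obtain ⟨Pq, hPq⟩ := exists_length_le_eval (codeFP_natParam hq)
  obtain ⟨g, hg, hE0, hEc, hE1⟩ := LiftPost.exists_postFn hq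
    (Polynomial.C 40 * Polynomial.X ^ 2 * Pq + Polynomial.C 100 * Polynomial.X + Polynomial.C 8) hbab
  refine ⟨g, hg, 2 * Polynomial.X + 1,
    Polynomial.C 40 * Polynomial.X ^ 2 * Pq + Polynomial.C 100 * Polynomial.X + Polynomial.C 8,
    2 * Polynomial.X, ?_⟩
  filter_upwards [hgood, hq2] with n hgoodn hq2n I ρ k y hIn hI d hd c hc
  subst hIn
  haveI : NeZero (q I.n) := ⟨by omega⟩
  haveI := I.isZLattice_of_isNonsingular hI
  -- the query as an opaque word `x`, with the three things we need to know about it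
  obtain ⟨hnx, hnlx⟩ := LiftPost.n_le_length_query I ρ k y c
  have hxE : LiftPre.xE (LiftPre.xOf I ρ k y c) = CVPOracle.query I ρ k y c := LiftPre.xE_mk I ρ k y c
  have hinput : ∀ (i : ℕ) (w yy : List Bool), boolPair (stageInput (CVPOracle.query I ρ k y c) i w) yy =
      pairE LiftPre.sE strE ((LiftPre.xOf I ρ k y c, i, w), yy) := fun i w yy => by
    rw [← LiftPre.sE_mk]; rfl
  have hAT : CVPOracle.answerTable I c = CVPOracle.tableZ c.2.2 (CVPOracle.coords I (CVPOracle.point I c)) := rfl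
  generalize hxq : CVPOracle.query I ρ k y c = x at hnx hnlx hxE hinput ⊢
  set dX : LiftPre.XData := LiftPre.xOf I ρ k y c with hdX
  set ms : Polynomial ℕ :=
    Polynomial.C 40 * Polynomial.X ^ 2 * Pq + Polynomial.C 100 * Polynomial.X + Polynomial.C 8 with hms
  have hmeval : ms.eval x.length = 40 * x.length ^ 2 * Pq.eval x.length + 100 * x.length + 8 := by
    simp [hms]
  generalize hmx : ms.eval x.length = m at hmeval ⊢
  set cq : ℕ := q I.n with hcq
  -- sizes
  have hsq : Nat.size cq ≤ Pq.eval I.n := by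
    have h := hPq I.n; rwa [length_natE, length_unE] at h
  have hfits : ∀ i ≤ 2 * I.n, (LiftPost.content cq I c i).length ≤ m := by
    intro i hi
    refine (LiftPost.length_content_le cq I c hc.1 i).trans ?_
    have h1 : Nat.size cq ≤ Pq.eval x.length := hsq.trans (TM2Iter.eval_mono Pq hnx)
    have h2 : I.n * (i * Nat.size cq) ≤ x.length * (2 * x.length * Pq.eval x.length) :=
      Nat.mul_le_mul hnx (Nat.mul_le_mul (hi.trans (Nat.mul_le_mul_left 2 hnx)) h1)
    rw [hmeval]
    nlinarith [h2, hnx, hnlx]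
  have htab : (CVPOracle.answerTable I c).length ≤ m := by
    rw [CVPOracle.length_answerTable]
    calc I.n * c.2.2 ≤ I.n * c.2.1 := Nat.mul_le_mul_left _ hc.2.1
      _ ≤ x.length := hnlx
      _ ≤ m := by rw [hmeval]; nlinarith
  -- the good windows
  set gw : ℕ → List Bool := fun i => if i = 0 then [] else if i < 2 * I.n then
      LiftPost.mkWindow m (List.ofFn (iter cq I (ratOf c) i)) (List.ofFn (LiftPost.psum cq I (ratOf c) i))
    else (CVPOracle.answerTable I c).takeD m false with hgw
  -- context identities
  have hnOf : LiftPost.nOf dX = I.n := rfl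
  have hmOf : LiftPost.mOf ms dX = m := by rw [LiftPost.mOf, hxE, hmx]
  have hrr : ∀ {i : ℕ} {yy : List Bool}, answerTable cq I (iter cq I (ratOf c) i) <+: yy →
      LiftPost.rrOf q dX yy = List.ofFn (digits cq I (iter cq I (ratOf c) i)) := fun h => by
    rw [LiftPost.rrOf, hnOf]; exact LiftPost.readN_answerTable I _ h
  have hgw0 : gw 0 = [] := by simp [hgw]
  refine ⟨gw, hgw0, ?_, ?_⟩
  · -- the final window carries the answer table
    have hTs : (2 * Polynomial.X + 1 : Polynomial ℕ).eval x.length = 2 * x.length + 1 := by simp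
    have h1 : 2 * x.length + 1 ≠ 0 := by omega
    have h2 : ¬ 2 * x.length + 1 < 2 * I.n := by omega
    rw [hTs]
    simp only [hgw, h1, h2, if_false]
    rw [LiftPost.takeD_of_length_le false m _ htab]
    exact List.prefix_append _ _
  · intro i hi
    have hpR : (2 * Polynomial.X : Polynomial ℕ).eval I.n = 2 * I.n := by simp
    rw [hpR]
    refine ⟨by by_cases h : i + 1 < 2 * I.n <;> simp [hgw, h], ?_⟩
    by_cases hw : i < 2 * I.n
    · left
      refine ⟨hw, fun hi0 => ?_, fun yy hyy => ?_⟩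
      · refine ⟨boolPair (rawE intE (List.ofFn (LiftPost.psum cq I (ratOf c) i)))
          (List.replicate (m - (LiftPost.content cq I c i).length) false), ?_⟩
        simp only [hgw, hi0, hw, if_false, if_true]
        rw [LiftPost.mkWindow_eq_pairE (hfits i hw.le)]
        rfl
      · by_cases hi0 : i = 0
        · -- stage 0 of a positive-dimensional instance
          subst hi0
          have hn1 : 0 < I.n := by omega
          have h1lt : 1 < 2 * I.n := by omega
          have hP0 : LiftPost.P0 ((dX, 0, []), yy) = true := by
            rw [show LiftPost.P0 ((dX, 0, []), yy) = (if (0 : ℕ) < 1 then decide (0 < LiftPost.nOf dX) else false)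
              from rfl, if_pos zero_lt_one, hnOf, decide_eq_true_iff]
            exact hn1
          rw [hgw0, hinput, hE0 _ hP0]
          have hstep : LiftPost.step0 q ((dX, 0, []), yy) = List.ofFn (iter cq I (ratOf c) 1) := by
            change LiftPost.stepL (q (LiftPost.nOf dX)) (LiftPre.ratList dX) (LiftPost.rrOf q dX yy) = _
            rw [hnOf, ← hcq, hrr hyy, LiftPre.ratList_mk I ρ k y c hc.1, iter_succ, iter_zero, LiftPost.stepL_ofFn]
          have hsums : LiftPost.sums0 q ((dX, 0, []), yy) = List.ofFn (LiftPost.psum cq I (ratOf c) 1) := by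
            change LiftPost.sumsL (q (LiftPost.nOf dX)) 0 (List.replicate (LiftPost.nOf dX) 0)
              (LiftPost.rrOf q dX yy) = _
            rw [hnOf, ← hcq, hrr hyy, ← List.ofFn_const, LiftPost.sumsL_ofFn, LiftPost.psum_succ]
            simp
          change LiftPost.mkWindow (LiftPost.mOf ms dX) (LiftPost.step0 q ((dX, 0, []), yy))
            (LiftPost.sums0 q ((dX, 0, []), yy)) = gw (0 + 1)
          rw [hmOf, hstep, hsums]
          simp [hgw, h1lt]
        · -- stages 1 … 2n−1: the window parses
          have hgwi : gw i = LiftPost.wE (List.ofFn (iter cq I (ratOf c) i),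
              List.ofFn (LiftPost.psum cq I (ratOf c) i),
              List.replicate (m - (LiftPost.content cq I c i).length) false) := by
            simp only [hgw, hi0, hw, if_false, if_true]; exact LiftPost.mkWindow_eq_pairE (hfits i hw.le)
          set b1 : LiftPost.W1Data := ((dX, i, (List.ofFn (iter cq I (ratOf c) i),
              List.ofFn (LiftPost.psum cq I (ratOf c) i),
              List.replicate (m - (LiftPost.content cq I c i).length) false)), yy) with hb1
          have hin : boolPair (stageInput x i (gw i)) yy = LiftPost.w1E b1 := by rw [hgwi, hinput]; rfl
          have hP0 : LiftPost.P0 (LiftPost.toS b1) = false := by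
            rw [show LiftPost.P0 (LiftPost.toS b1) = (if i < 1 then decide (0 < LiftPost.nOf dX) else false)
              from rfl, if_neg (by omega)]
          have hP3 : LiftPost.P3 (LiftPost.toS b1) = false := by
            rw [show LiftPost.P3 (LiftPost.toS b1) = decide (2 * LiftPost.nOf dX ≤ i) from rfl, hnOf,
              decide_eq_false_iff_not, not_le]
            exact hw
          rw [hin, hE1 b1 hP0 hP3]
          have hstep : LiftPost.step1 q b1 = List.ofFn (iter cq I (ratOf c) (i + 1)) := by
            change LiftPost.stepL (q (LiftPost.nOf dX)) (List.ofFn (iter cq I (ratOf c) i))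
              (LiftPost.rrOf q dX yy) = _
            rw [hnOf, ← hcq, hrr hyy, LiftPost.stepL_ofFn, iter_succ]
          have hsums : LiftPost.sums1 q b1 = List.ofFn (LiftPost.psum cq I (ratOf c) (i + 1)) := by
            change LiftPost.sumsL (q (LiftPost.nOf dX)) i (List.ofFn (LiftPost.psum cq I (ratOf c) i))
              (LiftPost.rrOf q dX yy) = _
            rw [hnOf, ← hcq, hrr hyy, LiftPost.sumsL_ofFn, LiftPost.psum_succ]
          by_cases hlast : i + 1 < 2 * I.n
          · rw [LiftPost.g1T, if_pos (show b1.1.2.1 + 1 < 2 * LiftPost.nOf b1.1.1 from hlast)]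
            change LiftPost.mkWindow (LiftPost.mOf ms dX) (LiftPost.step1 q b1) (LiftPost.sums1 q b1) = _
            rw [hmOf, hstep, hsums]
            simp [hgw, hlast]
          · -- the last round: finish
            have h2n : i + 1 = 2 * I.n := by omega
            rw [LiftPost.g1T, if_neg (show ¬ (b1.1.2.1 + 1 < 2 * LiftPost.nOf b1.1.1) from hlast),
              LiftPost.fin1]
            change (tableZL (LiftPost.bcOf dX) (LiftPost.finCoeffs (q (LiftPost.nOf dX)) (i + 1)
              (bab ((I, ρ), LiftPost.step1 q b1)) (LiftPost.sums1 q b1))).takeD (LiftPost.mOf ms dX) false = _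
            have hbc : LiftPost.bcOf dX = c.2.2 := by
              rw [LiftPost.bcOf, hxE]
              exact min_eq_left (hc.2.1.trans ((Nat.le_mul_of_pos_left c.2.1 (by omega)).trans hnlx))
            have hb : bab ((I, ρ), List.ofFn (iter cq I (ratOf c) (i + 1))) =
                List.ofFn (CVPOracle.coords I (DigitOracle.point I (iter cq I (ratOf c) (i + 1)))) := by
              rw [h2n]; exact hgoodn I ρ rfl hI d hd c hc
            have hfin : LiftPost.finCoeffs cq (i + 1)
                (List.ofFn (CVPOracle.coords I (DigitOracle.point I (iter cq I (ratOf c) (i + 1)))))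
                (List.ofFn (LiftPost.psum cq I (ratOf c) (i + 1))) =
                List.ofFn (CVPOracle.coords I (DigitOracle.point I (ratOf c))) := by
              rw [LiftPost.finCoeffs_ofFn]
              exact congrArg List.ofFn (funext fun j =>
                (coords_eq_pow_mul_coords_iter_add_sum cq I hd (admissible_ratOf I hc) j (i + 1)).symm)
            rw [hmOf, hnOf, ← hcq, hbc, hstep, hsums, hb, hfin, tableZL_ofFn, point_ratOf, ← hAT]
            have hne : i + 1 ≠ 0 := Nat.succ_ne_zero i
            simp only [hgw, hne, hlast, if_false]
    · -- idle stages
      right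
      intro yy
      have hP0 : LiftPost.P0 ((dX, i, gw i), yy) = false := by
        rw [show LiftPost.P0 ((dX, i, gw i), yy) = (if i < 1 then decide (0 < LiftPost.nOf dX) else false)
          from rfl, hnOf]
        split_ifs with h
        · rw [decide_eq_false_iff_not]; omega
        · rfl
      have hP3 : LiftPost.P3 ((dX, i, gw i), yy) = true := by
        rw [show LiftPost.P3 ((dX, i, gw i), yy) = decide (2 * LiftPost.nOf dX ≤ i) from rfl, hnOf,
          decide_eq_true_iff]
        omega
      rw [hinput, hEc _ hP0 hP3]
      change (gw i).takeD (LiftPost.mOf ms dX) false = gw (i + 1)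
      rw [hmOf]
      have hi1 : ¬ i + 1 < 2 * I.n := by omega
      by_cases hi0 : i = 0
      · subst hi0
        have hn0 : I.n * c.2.2 = 0 := Nat.mul_eq_zero.2 (Or.inl (by omega))
        have hA : CVPOracle.answerTable I c = [] :=
          List.eq_nil_of_length_eq_zero (by rw [CVPOracle.length_answerTable, hn0])
        have h1 : ¬ 1 < 2 * I.n := by omega
        simp [hgw, hA, h1]
      · simp only [hgw, hi0, hw, hi1, Nat.succ_ne_zero, if_false]
        rw [List.takeD_eq_take _ (by simp), List.take_of_length_le (by simp)]

end Literature.Computability.Cryptography
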